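import Literature.Geometry.ComplexHyperbolic.UnitBallKCentralOrbitalIntegralChart   -- ★ p843337: brings ★ `UnitBallInvariantMeasure` (`liftMeasure`, `liftMap`, `sec`), ★ `UnitaryBallGroupIntegral` (`bergmanVolume`, `map_orbit_haar_eq_smul_bergmanVolume`), ★ the chart
import Literature.Geometry.ComplexHyperbolic.UnitBallRegularConjugationFlag      -- (β-0) (this seat): the regular conjugate in base∕fibre coordinates
import HarnessLib

/-!
# The two-level integration formula on `U(2,1)`: `∫_G f dμ = c · ∫_{𝔹²} ∫_K f(sec z · k) dm_K(k) dβ(z) = 9c · ∫_{ℂ²} ∫_K f(sec(chart W) · k) dm_K d⁴W`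
# (ROAD A, road (β) toward (A6), brick (β-1b); Helgason 2000 Ch. I §1 Thm. 1.9; Rogawski 1990 §8.4 pp. 126–127)

Topic `Geometry/ComplexHyperbolic`; namespace `Literature.Geometry.ComplexHyperbolic.BallModel`.  THEOREMS ONLY (no `def`, no instance, no notation, no axiom, no named fact,
no `sorry`).  Cell `pub/hodgecm-mathlib`, ENGINE T1 (crux H413 = `stmt-HodgeConjecture-24833`); ROAD A (the (L_{U(2,1)}) letter `ArchCentralLimitFormulaRankTwo` = closer `stub_L21` ∕
SdArch `stub_ArchCentralLimitU21`), road (β) «direct `U(2,1)` geometry» toward the corner-regularity row (A6): brick (β-1b) of F0P3a-p05 (g13)'s SUCCESSOR PLAN («two-level formula: ★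
`HaarRightInvariantCompactSubgroup` with `K = stabilizer U21 x₀`, `φ = blockU`, `ρ` = Haar + ★ `map_orbit_haar_eq_smul_bergmanVolume`»); author F0P3a-p05 (g14), 2026-09-01.
Everything is over the tree's ★ `UnitBallInvariantMeasure` (the LIFT `ρ♯ = Ψ_*(ρ ⊗ m_K)` of a measure on the ball along `Ψ(z,k) = sec z · k`, Helgason's proof of Thm. 1.9) — this file turns
that construction into the INTEGRATION FORMULA it was built for, in the generality ROAD A needs (Bochner integrals of integrable `f`, any invariant Radon `ρ ≠ 0`, the Bergman volume, the chart).

THE MATHEMATICS.  `G = U(2,1)` acts transitively on the ball `𝔹² = G∕K`, `K = Stab(x₀) ≅ U(2) × U(1)` compact (★ `isCompact_stabilizer_x₀`); `sec : 𝔹² → G` is the continuous global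
section `sec z • x₀ = z` (★ `sec_smul_x₀`); `m_K` = the Haar PROBABILITY-up-to-scale measure `haar` of the compact group `K`.  For an invariant Radon measure `ρ ≠ 0` on `𝔹²`, the lift
`ρ♯ := Ψ_*(ρ ⊗ m_K)` is a left Haar measure on `G` (★ `isMulLeftInvariant_liftMeasure`, ★ `isFiniteMeasureOnCompacts_liftMeasure`), so for every Haar measure `μ` on `G`
`ρ♯ = a • μ` with `a = haarScalarFactor ρ♯ μ > 0` (§2), and unfolding the push-forward and Fubini (§1):

  **`∫_G f dμ = a⁻¹ • ∫_{𝔹²} ( ∫_K f(sec z · k) dm_K(k) ) dρ(z)`**   for every `f ∈ L¹(G, μ)` (§3, `integral_eq_inv_haarScalarFactor_smul_integral_integral_sec_mul`),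

`= 9a⁻¹ • ∫_{ℂ²} ∫_K f(sec(chart W) · k) dm_K d⁴W` for `ρ = β` the Bergman volume, through the hyperboloid chart `chart W = proj(W, √(1+|W|²))` (★ `integral_bergmanVolume_eq_chart`) (§4).
§5 specialises `f(g) = Θ(mat(g·t·g⁻¹))`, `t = diag(z₀,z₁,z₂)` a torus element: by (β-0) ★ `mat_conj_diagonal_sec_mul_stabilizer` the integrand in base∕fibre coordinates is
`Θ(z₁•1 + (z₂−z₁)•P(lift z) + (z₀−z₁)•N(secMat z *ᵥ (k₀₀,k₁₀,0)))` — THE TWO-LEVEL FORM OF THE REGULAR ORBITAL INTEGRAL (outer: the ball = negative lines; inner: the compact fibre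
`K∕(K ∩ T) = ℙ¹` of positive lines in `z^⊥`, as a `K`-average), stated under the integrability of `g ↦ Θ(mat(g·t·g⁻¹))` (properness of the regular orbit map is brick (β-1c), not here).  At
`z₀ = z₁` the inner integrand is constant in `k` and the formula collapses to ★ `exists_integral_comp_conj_kCentral_eq_smul_integral_of_smulInvariant` (the compact wall).
HONEST LABEL: HC_CM is proved only modulo the printed citations until rung 0 closes; this file is measure-theoretic bookkeeping over ★ ball-model files and pays nothing by itself.

## References
* [Helgason2000] S. Helgason, *Groups and Geometric Analysis* (2000), Ch. I §1 No. 2, Thm. 1.9 («`∫_G f(g) dg = ∫_{G∕H} (∫_H f(gh) dh) dg_H`»; its proof via the lift `f ↦ μ(f̄)`).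
* [Rogawski1990] J. D. Rogawski, *Automorphic Representations of Unitary Groups in Three Variables*, Ann. of Math. Stud. 123 (1990), §8.4 pp. 126–127 (orbital integrals on `U(2,1)` near the centre).
* [Folland1995] G. B. Folland, *A Course in Abstract Harmonic Analysis* (1995), §2.6 Thm. 2.49 (quotient integral formula `G → G∕H`).
* [Rudin1980] W. Rudin, *Function Theory in the Unit Ball of ℂⁿ* (1980), §2.2 (the invariant measure of the ball in coordinates).
-/

set_option autoImplicit false

noncomputable section

open Matrix Complex ComplexConjugate MeasureTheory Measure MulAction Topology Set Function
open Literature.AlgebraicGeometry.ShimuraVarieties.BallForms (bergmanVolume_ne_zero)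
open scoped ENNReal NNReal

namespace Literature.Geometry.ComplexHyperbolic

namespace BallModel

/-! ## §1 The lift formula: `∫_G f dρ♯ = ∫_{𝔹²} ∫_K f(sec z · k) dm_K dρ` -/

section Lift

variable {E : Type*} [NormedAddCommGroup E] [NormedSpace ℝ E]
variable (ρ : Measure Ball)

/-- `Ψ(z,k) = sec z · k` unfolds the lift: `∫_G f dρ♯ = ∫_{𝔹² × K} f(sec z · k) d(ρ ⊗ m_K)` for `f` a.e.-strongly measurable w.r.t. `ρ♯` (Mathlib `integral_map` along the continuous `Ψ`).
[cite: Helgason2000, Ch. I §1 No. 2, Thm. 1.9 (proof)] -/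
theorem integral_liftMeasure_eq_integral_prod (f : U21 → E) (hf : AEStronglyMeasurable f (liftMeasure ρ)) :
    ∫ g, f g ∂(liftMeasure ρ) = ∫ p : Ball × stabilizer U21 x₀, f (sec p.1 * (p.2 : U21)) ∂(ρ.prod (haar : Measure (stabilizer U21 x₀))) := by
  rw [liftMeasure] at hf ⊢
  rw [integral_map measurable_liftMap.aemeasurable hf]
  rfl

omit [NormedSpace ℝ E] in
/-- Integrability transfers along the lift: `f ∈ L¹(ρ♯) ↔ f ∘ Ψ ∈ L¹(ρ ⊗ m_K)` (for `f` a.e.-strongly measurable w.r.t. `ρ♯`). [cite: Helgason2000, Ch. I §1 No. 2, Thm. 1.9 (proof)] -/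
theorem integrable_liftMeasure_iff (f : U21 → E) (hf : AEStronglyMeasurable f (liftMeasure ρ)) :
    Integrable f (liftMeasure ρ) ↔ Integrable (fun p : Ball × stabilizer U21 x₀ => f (sec p.1 * (p.2 : U21))) (ρ.prod (haar : Measure (stabilizer U21 x₀))) := by
  rw [liftMeasure] at hf ⊢
  rw [integrable_map_measure hf measurable_liftMap.aemeasurable]
  rfl

/-- **THE LIFT FORMULA** (Helgason's `μ(f̄)`): for `f ∈ L¹(G, ρ♯)`, `∫_G f dρ♯ = ∫_{𝔹²} ( ∫_K f(sec z · k) dm_K(k) ) dρ(z)` (`ρ` s-finite; Fubini on `ρ ⊗ m_K`).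
[cite: Helgason2000, Ch. I §1 No. 2, Thm. 1.9 (proof)] -/
theorem integral_liftMeasure_eq_integral_integral [SFinite ρ] (f : U21 → E) (hf : Integrable f (liftMeasure ρ)) :
    ∫ g, f g ∂(liftMeasure ρ) = ∫ z, ∫ k : stabilizer U21 x₀, f (sec z * (k : U21)) ∂haar ∂ρ := by
  rw [integral_liftMeasure_eq_integral_prod ρ f hf.aestronglyMeasurable,
    integral_prod _ ((integrable_liftMeasure_iff ρ f hf.aestronglyMeasurable).1 hf)]

omit [NormedSpace ℝ E] in
/-- For `f ∈ C_c(G)` the pull-back `f ∘ Ψ` is continuous with compact support (`Ψ⁻¹(C) ⊆ π(C) × K`, `π(g) = g • x₀`, as in ★ `isFiniteMeasureOnCompacts_liftMeasure`), hence integrable for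
`ρ ⊗ m_K` when `ρ` is finite on compact sets. [cite: Helgason2000, Ch. I §1 No. 2, Thm. 1.9 (proof)] -/
theorem integrable_comp_liftMap_of_hasCompactSupport [IsFiniteMeasureOnCompacts ρ] (f : U21 → E) (hf : Continuous f) (hfc : HasCompactSupport f) :
    Integrable (fun p : Ball × stabilizer U21 x₀ => f (sec p.1 * (p.2 : U21))) (ρ.prod (haar : Measure (stabilizer U21 x₀))) := by
  have hc : Continuous fun p : Ball × stabilizer U21 x₀ => f (sec p.1 * (p.2 : U21)) := hf.comp continuous_liftMap
  have hπ : Continuous fun g : U21 => g • x₀ := continuous_id.smul continuous_const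
  have hsupp : HasCompactSupport fun p : Ball × stabilizer U21 x₀ => f (sec p.1 * (p.2 : U21)) := by
    refine HasCompactSupport.of_support_subset_isCompact ((hfc.image hπ).prod isCompact_univ) ?_
    intro p hp
    refine ⟨⟨sec p.1 * (p.2 : U21), subset_tsupport _ hp, ?_⟩, mem_univ _⟩
    exact liftMap_smul_x₀ p
  exact hc.integrable_of_hasCompactSupport hsupp

/-- **THE LIFT FORMULA FOR `f ∈ C_c(G)`**: `∫_G f dρ♯ = ∫_{𝔹²} ∫_K f(sec z · k) dm_K dρ`, `ρ` any measure finite on compact sets. [cite: Helgason2000, Ch. I §1 No. 2, Thm. 1.9 (proof)] -/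
theorem integral_liftMeasure_eq_integral_integral_of_hasCompactSupport [IsFiniteMeasureOnCompacts ρ] (f : U21 → E) (hf : Continuous f) (hfc : HasCompactSupport f) :
    ∫ g, f g ∂(liftMeasure ρ) = ∫ z, ∫ k : stabilizer U21 x₀, f (sec z * (k : U21)) ∂haar ∂ρ := by
  rw [integral_liftMeasure_eq_integral_prod ρ f hf.aestronglyMeasurable, integral_prod _ (integrable_comp_liftMap_of_hasCompactSupport ρ f hf hfc)]

end Lift

/-! ## §2 The lift of an invariant Radon measure `ρ ≠ 0` is a positive multiple of every Haar measure -/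

section Scalar

variable (μ : Measure U21) [μ.IsHaarMeasure] (ρ : Measure Ball) [SMulInvariantMeasure U21 Ball ρ] [IsFiniteMeasureOnCompacts ρ]

/-- `ρ♯ = a • μ`, `a = haarScalarFactor ρ♯ μ` (uniqueness of left Haar measure, Mathlib `isMulLeftInvariant_eq_smul`; the lift is left invariant and finite on compact sets ★).
[cite: Helgason2000, Ch. I §1 No. 2, Thm. 1.9] -/
theorem liftMeasure_eq_haarScalarFactor_smul : liftMeasure ρ = haarScalarFactor (liftMeasure ρ) μ • μ :=
  isMulLeftInvariant_eq_smul (liftMeasure ρ) μ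

omit [SMulInvariantMeasure U21 Ball ρ] in
/-- `π_* ρ♯ = m_K(K) • ρ` with `m_K(K) ≠ 0`: the lift of a non-zero measure is non-zero. [cite: Helgason2000, Ch. I §1 No. 2, Thm. 1.9 (proof)] -/
theorem liftMeasure_ne_zero (hρ : ρ ≠ 0) : liftMeasure ρ ≠ 0 := by
  intro h
  have hm : (haar : Measure (stabilizer U21 x₀)) univ ≠ 0 := isOpen_univ.measure_ne_zero _ univ_nonempty
  have h1 := map_orbit_liftMeasure ρ
  rw [h, Measure.map_zero] at h1
  have h2 : (haar : Measure (stabilizer U21 x₀)) univ * ρ univ = 0 := by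
    have h3 := congrArg (fun ν : Measure Ball => ν univ) h1
    simpa only [Measure.smul_apply, smul_eq_mul, Measure.coe_zero, Pi.zero_apply] using h3.symm
  exact hρ (Measure.measure_univ_eq_zero.1 ((mul_eq_zero.1 h2).resolve_left hm))

/-- **`a = haarScalarFactor ρ♯ μ > 0`** for `ρ ≠ 0`. [cite: Helgason2000, Ch. I §1 No. 2, Thm. 1.9] -/
theorem haarScalarFactor_liftMeasure_pos (hρ : ρ ≠ 0) : 0 < haarScalarFactor (liftMeasure ρ) μ := by
  refine pos_iff_ne_zero.2 fun h => liftMeasure_ne_zero ρ hρ ?_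
  have h1 := liftMeasure_eq_haarScalarFactor_smul μ ρ
  rw [h, zero_smul] at h1
  exact h1

/-- Integrability for `μ` is integrability for `ρ♯` (`ρ♯ = a • μ`, `0 < a < ∞`). [cite: Helgason2000, Ch. I §1 No. 2, Thm. 1.9] -/
theorem integrable_liftMeasure_iff_integrable {E : Type*} [NormedAddCommGroup E] (hρ : ρ ≠ 0) (f : U21 → E) :
    Integrable f (liftMeasure ρ) ↔ Integrable f μ := by
  have h1 := liftMeasure_eq_haarScalarFactor_smul μ ρ
  have ha : ((haarScalarFactor (liftMeasure ρ) μ : ℝ≥0) : ℝ≥0∞) ≠ 0 := by exact_mod_cast (haarScalarFactor_liftMeasure_pos μ ρ hρ).ne'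
  rw [ENNReal.smul_def] at h1
  conv_lhs => rw [h1]
  exact integrable_smul_measure ha ENNReal.coe_ne_top

/-- `∫_G f dρ♯ = a • ∫_G f dμ`. [cite: Helgason2000, Ch. I §1 No. 2, Thm. 1.9] -/
theorem integral_liftMeasure_eq_haarScalarFactor_smul_integral {E : Type*} [NormedAddCommGroup E] [NormedSpace ℝ E] (f : U21 → E) :
    ∫ g, f g ∂(liftMeasure ρ) = (haarScalarFactor (liftMeasure ρ) μ : ℝ) • ∫ g, f g ∂μ := by
  have h1 := liftMeasure_eq_haarScalarFactor_smul μ ρ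
  conv_lhs => rw [h1]
  rw [integral_smul_nnreal_measure, NNReal.smul_def]

end Scalar

/-! ## §3 The two-level formula against an invariant Radon measure on the ball -/

section TwoLevel

variable {E : Type*} [NormedAddCommGroup E] [NormedSpace ℝ E]
variable (μ : Measure U21) [μ.IsHaarMeasure] (ρ : Measure Ball) [SMulInvariantMeasure U21 Ball ρ] [IsFiniteMeasureOnCompacts ρ]

/-- **THE TWO-LEVEL INTEGRATION FORMULA ON `U(2,1)`** (`G → G∕K = 𝔹²`): for a Haar measure `μ` on `G = U(2,1)`, an invariant Radon measure `ρ ≠ 0` on the ball and `f ∈ L¹(G, μ)`,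
`∫_G f dμ = a⁻¹ • ∫_{𝔹²} ( ∫_K f(sec z · k) dm_K(k) ) dρ(z)`, `a = haarScalarFactor ρ♯ μ > 0`, `K = Stab(x₀)`, `m_K = haar`. [cite: Helgason2000, Ch. I §1 No. 2, Thm. 1.9]
[cite: Folland1995, §2.6 Thm. 2.49] -/
theorem integral_eq_inv_haarScalarFactor_smul_integral_integral_sec_mul (hρ : ρ ≠ 0) (f : U21 → E) (hf : Integrable f μ) :
    ∫ g, f g ∂μ = ((haarScalarFactor (liftMeasure ρ) μ : ℝ))⁻¹ • ∫ z, ∫ k : stabilizer U21 x₀, f (sec z * (k : U21)) ∂haar ∂ρ := by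
  have ha : (haarScalarFactor (liftMeasure ρ) μ : ℝ) ≠ 0 := by exact_mod_cast (haarScalarFactor_liftMeasure_pos μ ρ hρ).ne'
  rw [← integral_liftMeasure_eq_integral_integral ρ f ((integrable_liftMeasure_iff_integrable μ ρ hρ f).2 hf),
    integral_liftMeasure_eq_haarScalarFactor_smul_integral μ ρ f, smul_smul, inv_mul_cancel₀ ha, one_smul]

/-- The same for `f ∈ C_c(G)` (no integrability bookkeeping). [cite: Helgason2000, Ch. I §1 No. 2, Thm. 1.9] -/
theorem integral_eq_inv_haarScalarFactor_smul_integral_integral_sec_mul_of_hasCompactSupport (hρ : ρ ≠ 0) (f : U21 → E) (hf : Continuous f) (hfc : HasCompactSupport f) :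
    ∫ g, f g ∂μ = ((haarScalarFactor (liftMeasure ρ) μ : ℝ))⁻¹ • ∫ z, ∫ k : stabilizer U21 x₀, f (sec z * (k : U21)) ∂haar ∂ρ :=
  integral_eq_inv_haarScalarFactor_smul_integral_integral_sec_mul μ ρ hρ f (hf.integrable_of_hasCompactSupport hfc)

/-- **∃-FORM**: there is ONE `c > 0` (per `μ`, `ρ`) with `∫_G f dμ = c • ∫_{𝔹²} ∫_K f(sec z · k) dm_K dρ` for every `f ∈ L¹(G, μ)`. [cite: Helgason2000, Ch. I §1 No. 2, Thm. 1.9] -/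
theorem exists_integral_eq_smul_integral_integral_sec_mul (hρ : ρ ≠ 0) :
    ∃ c : ℝ, 0 < c ∧ ∀ f : U21 → E, Integrable f μ → ∫ g, f g ∂μ = c • ∫ z, ∫ k : stabilizer U21 x₀, f (sec z * (k : U21)) ∂haar ∂ρ :=
  ⟨((haarScalarFactor (liftMeasure ρ) μ : ℝ))⁻¹, inv_pos.2 (by exact_mod_cast haarScalarFactor_liftMeasure_pos μ ρ hρ),
    fun f hf => integral_eq_inv_haarScalarFactor_smul_integral_integral_sec_mul μ ρ hρ f hf⟩

end TwoLevel

/-! ## §4 Against the Bergman volume, and in the hyperboloid chart -/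

section Bergman

variable {E : Type*} [NormedAddCommGroup E] [NormedSpace ℝ E]
variable (μ : Measure U21) [μ.IsHaarMeasure]

/-- **TWO-LEVEL FORMULA AGAINST THE BERGMAN VOLUME**: `∫_G f dμ = a_β⁻¹ • ∫_{𝔹²} ∫_K f(sec z · k) dm_K dβ(z)`, `a_β = haarScalarFactor β♯ μ > 0` (★ `bergmanVolume_ne_zero`,
★ `smulInvariantMeasure_bergmanVolume`). [cite: Helgason2000, Ch. I §1 No. 2, Thm. 1.9] [cite: Rudin1980, §2.2] -/
theorem integral_eq_smul_integral_bergmanVolume_integral_sec_mul (f : U21 → E) (hf : Integrable f μ) :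
    ∫ g, f g ∂μ = ((haarScalarFactor (liftMeasure bergmanVolume) μ : ℝ))⁻¹ • ∫ z, ∫ k : stabilizer U21 x₀, f (sec z * (k : U21)) ∂haar ∂bergmanVolume :=
  integral_eq_inv_haarScalarFactor_smul_integral_integral_sec_mul μ bergmanVolume bergmanVolume_ne_zero f hf

/-- **TWO-LEVEL FORMULA IN THE HYPERBOLOID CHART**: `∫_G f dμ = 9a_β⁻¹ • ∫_{ℂ²} ∫_K f(sec(chart W) · k) dm_K d⁴W`, `chart W = proj(W, √(1+|W|²))` (★ `integral_bergmanVolume_eq_chart`,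
valid for any integrand). [cite: Helgason2000, Ch. I §1 No. 2, Thm. 1.9] [cite: Rudin1980, §2.2] -/
theorem integral_eq_smul_integral_chart_integral_sec_mul (f : U21 → E) (hf : Integrable f μ) :
    ∫ g, f g ∂μ = ((9 : ℝ) * ((haarScalarFactor (liftMeasure bergmanVolume) μ : ℝ))⁻¹) •
      ∫ W : Fin 2 → ℂ, ∫ k : stabilizer U21 x₀, f (sec (proj ![W 0, W 1, (Real.sqrt (1 + nsq W) : ℂ)] (Q_vecCons_sqrt_one_add_nsq_neg W)) * (k : U21)) ∂haar := by
  rw [integral_eq_smul_integral_bergmanVolume_integral_sec_mul μ f hf, integral_bergmanVolume_eq_chart, smul_smul, mul_comm]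

/-- ∃-form of the chart formula: ONE `c > 0` per `μ` with `∫_G f dμ = c • ∫_{ℂ²} ∫_K f(sec(chart W) · k) dm_K d⁴W` for all `f ∈ L¹(G, μ)`. [cite: Helgason2000, Ch. I §1 No. 2, Thm. 1.9] -/
theorem exists_integral_eq_smul_integral_chart_integral_sec_mul :
    ∃ c : ℝ, 0 < c ∧ ∀ f : U21 → E, Integrable f μ →
      ∫ g, f g ∂μ = c • ∫ W : Fin 2 → ℂ, ∫ k : stabilizer U21 x₀, f (sec (proj ![W 0, W 1, (Real.sqrt (1 + nsq W) : ℂ)] (Q_vecCons_sqrt_one_add_nsq_neg W)) * (k : U21)) ∂haar :=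
  ⟨(9 : ℝ) * ((haarScalarFactor (liftMeasure bergmanVolume) μ : ℝ))⁻¹,
    mul_pos (by norm_num) (inv_pos.2 (by exact_mod_cast haarScalarFactor_liftMeasure_pos μ bergmanVolume bergmanVolume_ne_zero)),
    fun f hf => integral_eq_smul_integral_chart_integral_sec_mul μ f hf⟩

end Bergman

/-! ## §5 The regular orbital integral in two levels -/

section Orbital

variable {E : Type*} [NormedAddCommGroup E] [NormedSpace ℝ E]
variable (μ : Measure U21) [μ.IsHaarMeasure] (ρ : Measure Ball) [SMulInvariantMeasure U21 Ball ρ] [IsFiniteMeasureOnCompacts ρ]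

/-- **THE ORBITAL INTEGRAL OF A TORUS ELEMENT OF `U(2,1)` IN TWO LEVELS**: for `t = diag(w₀,w₁,w₂)`, `w_p ∈ S¹`, every Haar `μ`, every invariant Radon `ρ ≠ 0` on the ball and every
`Θ : M₃(ℂ) → E` with `g ↦ Θ(mat(g·t·g⁻¹))` integrable:
`∫_G Θ(mat(g·t·g⁻¹)) dμ = a⁻¹ • ∫_{𝔹²} ∫_K Θ( w₁•1 + (w₂−w₁)•P(lift z) + (w₀−w₁)•N(secMat z *ᵥ (k₀₀,k₁₀,0)) ) dm_K(k) dρ(z)` — outer integral over the negative line `z` (the pencil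
`P`), inner `K`-average over the positive line `ℂ·secMat z (k₀₀,k₁₀,0) ⊂ z^⊥` (★ (β-0) `mat_conj_diagonal_sec_mul_stabilizer`).  At `w₀ = w₁` the inner integrand is constant in `k`.
[cite: Rogawski1990, §8.4 pp. 126–127] [cite: Helgason2000, Ch. I §1 No. 2, Thm. 1.9] -/
theorem integral_comp_conj_diagonal_eq_smul_integral_integral (hρ : ρ ≠ 0) (w : Fin 3 → Circle)
    (hw : (Matrix.diagonal fun i => (w i : ℂ))ᴴ * J * Matrix.diagonal (fun i => (w i : ℂ)) = J) (Θ : Matrix (Fin 3) (Fin 3) ℂ → E)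
    (hΘ : Integrable (fun g : U21 => Θ (mat (g * mkU21 (Matrix.diagonal fun i => (w i : ℂ)) hw * g⁻¹))) μ) :
    ∫ g, Θ (mat (g * mkU21 (Matrix.diagonal fun i => (w i : ℂ)) hw * g⁻¹)) ∂μ =
      ((haarScalarFactor (liftMeasure ρ) μ : ℝ))⁻¹ • ∫ z, ∫ k : stabilizer U21 x₀,
        Θ ((w 1 : ℂ) • (1 : Matrix (Fin 3) (Fin 3) ℂ)
            + ((w 2 : ℂ) - w 1) • ((((Q (lift z) : ℝ) : ℂ))⁻¹ • (vecMulVec (lift z) (star (lift z)) * J))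
            + ((w 0 : ℂ) - w 1) • (vecMulVec (secMat z *ᵥ ![mat (k : U21) 0 0, mat (k : U21) 1 0, 0])
                (star (secMat z *ᵥ ![mat (k : U21) 0 0, mat (k : U21) 1 0, 0])) * J)) ∂haar ∂ρ := by
  rw [integral_eq_inv_haarScalarFactor_smul_integral_integral_sec_mul μ ρ hρ _ hΘ]
  simp_rw [mat_conj_diagonal_sec_mul_stabilizer]

/-- The same in the hyperboloid chart against the Bergman volume (`ρ = β`, ★ `integral_bergmanVolume_eq_chart`): outer integral `d⁴W` over `ℂ²`, base point `chart W`.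
[cite: Rogawski1990, §8.4 pp. 126–127] [cite: Rudin1980, §2.2] -/
theorem integral_comp_conj_diagonal_eq_smul_integral_chart_integral (w : Fin 3 → Circle)
    (hw : (Matrix.diagonal fun i => (w i : ℂ))ᴴ * J * Matrix.diagonal (fun i => (w i : ℂ)) = J) (Θ : Matrix (Fin 3) (Fin 3) ℂ → E)
    (hΘ : Integrable (fun g : U21 => Θ (mat (g * mkU21 (Matrix.diagonal fun i => (w i : ℂ)) hw * g⁻¹))) μ) :
    ∫ g, Θ (mat (g * mkU21 (Matrix.diagonal fun i => (w i : ℂ)) hw * g⁻¹)) ∂μ =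
      ((9 : ℝ) * ((haarScalarFactor (liftMeasure bergmanVolume) μ : ℝ))⁻¹) • ∫ W : Fin 2 → ℂ, ∫ k : stabilizer U21 x₀,
        Θ ((w 1 : ℂ) • (1 : Matrix (Fin 3) (Fin 3) ℂ)
            + ((w 2 : ℂ) - w 1) • ((((Q (lift (proj ![W 0, W 1, (Real.sqrt (1 + nsq W) : ℂ)] (Q_vecCons_sqrt_one_add_nsq_neg W))) : ℝ) : ℂ))⁻¹ •
                (vecMulVec (lift (proj ![W 0, W 1, (Real.sqrt (1 + nsq W) : ℂ)] (Q_vecCons_sqrt_one_add_nsq_neg W)))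
                  (star (lift (proj ![W 0, W 1, (Real.sqrt (1 + nsq W) : ℂ)] (Q_vecCons_sqrt_one_add_nsq_neg W)))) * J))
            + ((w 0 : ℂ) - w 1) • (vecMulVec (secMat (proj ![W 0, W 1, (Real.sqrt (1 + nsq W) : ℂ)] (Q_vecCons_sqrt_one_add_nsq_neg W)) *ᵥ ![mat (k : U21) 0 0, mat (k : U21) 1 0, 0])
                (star (secMat (proj ![W 0, W 1, (Real.sqrt (1 + nsq W) : ℂ)] (Q_vecCons_sqrt_one_add_nsq_neg W)) *ᵥ ![mat (k : U21) 0 0, mat (k : U21) 1 0, 0])) * J)) ∂haar := by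
  rw [integral_eq_smul_integral_chart_integral_sec_mul μ _ hΘ]
  simp_rw [mat_conj_diagonal_sec_mul_stabilizer]

end Orbital

end BallModel

end Literature.Geometry.ComplexHyperbolic

end
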